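import Mathlib
import Summits.Langlands.Langlands.Theorems.QuadraticWindowHostInducedRepSignedTwistAux

/-!
# The automorphic package of line `one-transparent-pane` — stub `stub_package` of the crux
# `Summit.Langlands.Langlands.Theses.QuadraticWindow.HostInducedRep` (stmt-Langlands-10902):
# helper file 1/2 — the fact-free bookkeeping (sign logic, Satake → host-polynomial dictionary)

LOG (worker `stub_package`, 2026-08-16).  VERDICT on the registered signature (skeleton
`Cruxes/HostInducedRep/Lines/one-transparent-pane.lean` ll. 231–297): `stub-misstated`.  (1) Its
conclusion (abstract family `K_j`, control at EVERY place over good split `v ∉ E_j`) no longer matches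
the reshaped consumers (`stub_patch`: family `QuadraticFamily.GoodPrime F₀ m B`, control a.e. per
member + coverage at ONE split place; `stub_galoisOverK_cond`); (2) its hypothesis list is too short:
besides `hpane` the intended proof (docstring ll. 217–220: "the pin at a pane gives
`(-1)^{m_u+k} = κ_{P_j}`") uses the SIGN PIN (statement of `stub_signPin`) to make the parity
`v ↦ det e(c_v)` constant on the complex-type real places of `F₀` — `hpane` alone cannot see a member
in which one pane is of type I and another of type II — and it uses unproved published facts.
Corrected signature = `stub_package'` of the work file `Package3.lean` (CHECKED composition,
rc 0, one `sorry` = the sub-stub `pkg_member`):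

  `stub_package' (hAI) (hBC) (harch) (hHen) (hinf) (hext) (hMok) (hpin) (hpane) :`
  `  <registered prefix: F₀ F τ hTR hdeg hτ n hcpt π e k hreg hpol hpar ℓ ι eψ hψpar hψnti>`
  `  → ¬ IsTotallyReal F → <RESHAPED CONCLUSION>`

with the RESHAPED CONCLUSION (elaborates; it is verbatim the conclusion of `stub_package_of_member`,
helper file 2/2 `Package2.lean`, PROVED):

  `∃ (m : ℕ) (B : Set ℕ), m ≠ 0 ∧ B.Finite ∧`
  `∃ (hK : ∀ D : GoodPrime F₀ m B, isCompact_glFiniteIntegralLevel (2 * n) (sqrtNegField F₀ D.1))`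
  `  (τ' : ∀ D, CuspidalAutomorphicRepData (2 * n) (sqrtNegField F₀ D.1) (hK D))`
  `  (T : ∀ D, InfinityType (sqrtNegField F₀ D.1) (2 * n)) (ψ₁ : ∀ D, HeckeCharacter (sqrtNegField F₀ D.1)),`
  `  (∀ D [IsCMField (sqrtNegField F₀ D.1)], HasInfinityType ∧ IsCAlgebraic ∧ IsWeaklyRegular ∧`
  `     IsConjSelfDualAE (complexConj _) ∧ HasAsaiSign (complexConj _) 1 ∧ (ψ₁ D).IsAlgebraic) ∧`
  `  (∀ D, ∀ᶠ u in cofinite, ∀ v α c, u.under (𝓞 F₀) = v → ℓ ∉ v → Guard v α c →`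
  `     ℓ ∉ u ∧ (ψ₁ D).IsUnramifiedAt u ∧ ∃ β, (τ' D).1.HasSatakeParamAt u β ∧`
  `     arithFrobPolyOfSatake ι q_u (2n) (β.map (· * ((ψ₁ D).valueAtUniformizer u)⁻¹)) =`
  `       ((hostPoly v α c).roots.map (fun x ↦ X - C (x ^ f(u∣v)))).prod) ∧`
  `  (∀ v α c, ℓ ∉ v → Guard v α c → ∃ D, ncard (v.asIdeal.primesOver (𝓞 K_D)) = 2 ∧`
  `     ∃ u, u.under (𝓞 F₀) = v ∧ ℓ ∉ u ∧ (ψ₁ D).IsUnramifiedAt u ∧ ∃ β, … = hostPoly v α c)`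

(`Guard`, `hostPoly` expanded verbatim as in the crux; the CM instance is a `[…]` binder since
`IsCMField` is a `Prop`, supplied by `GoodPrime.isCMField (Or.inl hTR) D`).  The new sub-stub
`pkg_member` (Package3.lean, sorried; exact Lean signature there) is the statement for ONE abstract
CM quadratic `K/F₀` ramified at a guarded place and admitting no `F₀`-embedding of `F`; the family
bookkeeping `pkg_member ⇒ stub_package'` is proved (`stub_package_of_member`).

## Files of this worker (all landable files: rc 0, 0 warnings, 0 sorries, standard axioms,
## gate dry-run ACCEPT; NOT proposed for real per the lead's instruction; no imports between them)
* `Package.lean` (this file; target `…/QuadraticWindowHostInducedRepPackageSign.lean`): the LOG and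
  inventory, and §1 the sign logic (h) as abstract lemmas (`exists_switch_const`, `exists_xi`,
  `negOnePow_typeI`, `exists_int_add_half_of_parity`).
* `PackageDict.lean` (target `…PackageDict.lean`): §2 the dictionary (i) in the consumers' currency
  (`arithFrobPolyOfSatake_map_mul_inv_sqrt_pow`: `(√q)^{2n-1} q^{-n/2} = (√q)^{n-1}`;
  `arithFrobPolyOfSatake_pow_map_mul_inv_sqrt_pow`: residue degree `f`, powers polynomial;
  `dictionary_powers` = the control-a.e. shape of `stub_patch`, `dictionary_split` = its coverage
  shape); §3 the twist by an ARBITRARY Hecke character at a prescribed unramified place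
  (`heckeCharacter_exists_level_not_dvd`, `hasSatakeParamAt_twist_hecke_placewise`); §3b norm shifts
  at uniformizers (`ψ₁(ϖ_u) = ψ₀(ϖ_u)(√q_u)^n`); §3c **`member_dictionary(_split)`**: placewise BC +
  placewise twist + norm shift + dictionary ⟹ VERBATIM the dictionary clauses of `pkg_member` at one
  place `u` (powers form / `hostPoly` form) — the core of DICT-AE and COV, PROVED.
* `PackageHecke.lean` (target `…PackageHecke.lean`): restriction of Hecke characters along
  `AdeleRing.ideleBaseChange F₀ K` as an existence theorem (`heckeCharacter_exists_restrict`;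
  unitarity / finite order preserved; `isUnramifiedAt_restrict`; `valueAtUniformizer_restrict`:
  `χ|(ϖ_v) = ∏_{w∣v} χ(ϖ_w)` over `v` unramified in `K`).
* `PackagePolar.lean` (target `…PackagePolar.lean`): §4 the multiset algebra of the a.e. conjugate
  self-duality of `τ'` and **`inducedParam_map_inv`** — the induced Satake parameter `B` at `v` of the
  twisted family of a `τ`-polarized `π` satisfies `B⁻¹ = B · (cₑ q_v^k ∏_{w∣v} c_w)⁻¹` (split/inert
  fibre analysis), the `Π`-level half of `IsConjSelfDualAE` for `τ'`, PROVED.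
* `Package2.lean` (target `…PackageFamily.lean`): **`stub_package_of_member`** — the reshaped
  `stub_package` PROVED modulo the abstract member hypothesis `hmember` (bad primes `B` from
  `eventually_guard`, ramification over `ℚ` and `finite_setOf_prime_isSquare_neg`; ramified guarded
  place via `not_isUnramifiedIn_sqrtNegField`; coverage via `GoodPrime.exists_split`).
* `Package3.lean` (work file, NOT landable): `pkg_member` (sorried, full hypotheses) +
  `stub_package'` (checked composition, rc 0 with the one sorry) + the NEW fact
  `HewittRoss_character_extension_of_closed_subgroup` + the PLAN for `pkg_member` with sizes.
* `scratch_pkg/Sig0.lean`: the reshaped conclusion as a `def`, elaborates; `scratch_pkg/Compose.lean`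
  (rc 0, no sorry): END-TO-END INTERFACE TEST — hypotheses = the reshaped conclusion above, the
  registered conclusion shape of `stub_galoisOverK`, and the statement of the patch worker's reshaped
  `stub_patch` (copied verbatim from `work/stubs/Patch.lean`); conclusion = the crux's
  `∃ R, IsSemisimple ∧ ∀ v α c, ℓ ∉ v → Guard → R unramified at v ∧ charpoly = hostPoly` (the lead's
  `HostInducedRep_of` threading for the three reshaped stubs, checked); `scratch_pkg/DictMember.lean`
  (superseded by PackageDict.lean).

## Inventory (P1) — tree API per step of the intended construction (file:line; P = proved,
## F = named fact (unproved `def … : Prop`), M = missing)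
(a) `ψ` from `eψ`: F→P `artinReciprocity_character` DISCHARGED
    (`ArtinCharacterReciprocityProofs.lean:461 artinReciprocity_character_holds`: finite-order `ω`,
    unramified with `eψ.HasFrobCharpolyAt w (X - C (ω(ϖ_w)))` wherever `eψ` is unramified);
    `π' := π.twist ω hfin` (P, `AutomorphicTwistBJ.lean:620`); Satake of the twist at EVERY unramified
    place (P, `Theorems/QuadraticWindowHostInducedRepInducedPackageAux.lean:
    hasSatakeParamAt_twist_at_unramified_place`); `π'` not Galois-stable from `hψnti`
    (P, `…InducedPackage.lean:142 not_isGaloisStableSatakeAE_twist`); arch parameter unchanged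
    (P, `AutomorphicTwistWeightOne.lean:114 HasArchParameter.twist`).
(b) `Π := AI(π')`: F `automorphicInduction_cyclic_cuspidal_unramified`
    (`AutomorphicInductionCuspidalUnramified.lean:87`, AC Thm 4.2(e)+5.1+6.2+L.6.4 / Henniart Thms 3,5,
    PLACEWISE at every place unramified in `F` above which `π'` is unramified) ⇒ P
    `…InducedPackage.lean: stub_inducedPackage_of_automorphicInduction` (needs the bundle `Hyps` incl.
    `hodd hℓ hunr hψunr`, which `stub_package` does not have — re-derive its 40 lines: the proof
    uses only `hdeg`, `hψnti` and, for the rider `ℓ ∤ disc F₀` that we do not need, `hℓ`); a.e. forms `automorphicInduction_cyclic(_cuspidal)` (F),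
    `IsAutomorphicInductionAlong` (def, a.e., `BaseChangeInductionAlong.lean:388`).
(c) family: P `QuadraticFamily.GoodPrime/sqrtNegField` (`SGeneralQuadraticFamily.lean:626/277`),
    `GoodPrime.exists_split :691`, `.sGeneral :655`, `.exists_framedGaloisRep :739`, CM structure
    `GoodPrime.isCMField (Or.inl hTR)` (`ReciprocityGLnPatchingFamily.lean:333`).  `Π_K := BC(Π)`
    cuspidal PLACEWISE: M as a `def`, but its exact statement is the hypothesis `hBC` of the tree's
    `ReciprocityGLnExistenceProofs.lean:516 theoremA_existence_of_baseChange` (AC Thm 4.2(a)+5.1;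
    predicate `IsUnramifiedBaseChangeLift`, `BaseChangeUnramifiedLift.lean:135`, whose docstring prints
    the statement) — its hypothesis "a place ramified in `K` at which `Π` is unramified" REPLACES the
    self-twist exclusion `Π ≇ Π ⊗ ω_K` (no finiteness-of-self-twists fact needed): for `K = F₀(√-D)`
    take `v₀ ∣ D` (`not_isUnramifiedIn_sqrtNegField`, `intValuation_natCast_eq_of_isUnramifiedAt`,
    `ReciprocityGLnExistenceProofs.lean:180/156`) — done in `stub_package_of_member`.  a.e. forms:
    F `exists_baseChange_cyclic` (`BaseChangeGLn.lean:101`), F `baseChange_cyclic_cuspidal`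
    (`BaseChangeCyclicCuspidal.lean:98`, needs an inert place with `-α ≠ α`:
    `RamakrishnanTheoremMExistence.lean:576 exists_inert_satake_ne_of_not_isQuadraticSelfTwistAE`).
(d) `ψ₀`: M.  Needed: extension of the unitary idele class character `χ₀ = χ'⁻¹ξ` of `F₀` to `K`,
    unramified on a prescribed set `U` of places (`hext` of `pkg_member`, TRUE: well-definedness on
    `𝕀_{F₀}K^×∏_U 𝒪_u^×` uses `y_∞ = 1 ⇒ c(k) = k`; closedness + open mapping; then Pontryagin) ⇐
    NEW fact `HewittRoss_character_extension_of_closed_subgroup` (Package3; Hewitt–Ross I (24.12) =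
    Rudin, Fourier Analysis on Groups, Thm 2.1.4 — bib key `Rudin1962FourierGroups` exists; LOCATOR TO
    BE DOUBLE-CHECKED, no held copy).  Tree: `HeckeCharacter` group structure, `IsUnitary`,
    `normCharacter` (`HeckeCharacterNormCharacter.lean:104`), `‖·‖^s`
    (`IdeleNormDetGL.lean:71 exists_heckeCharacter_ideleNorm_cpow`), `compRelNorm` (`χ ∘ N_{E/F}`,
    `GlobalArtinMapNormProofs.lean:203`), `AdeleRing.ideleBaseChange` (`AdeleBaseChange.lean:354`,
    continuous, injective), `χ.baseChange` (`Sweep1BaseChangeGLOne.lean:90`), prime-index extension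
    `exists_continuousMonoidHom_extend_of_index_prime` (`ArthurClozelCuspidalDescentGLOne.lean:203`,
    open subgroups only), CFT characters `exists_isClassFieldCharacter_holds`
    (`ExistsClassFieldCharacterHolds.lean:182`, for `ξ = ω_K` and `ω_{F/F₀}`), Weil/Patrikis
    F `HeckeCharacter.exists_of_unitaryArchParams_iff` (`HeckeCharacterArchExistence.lean:80`, not
    needed), CHT Lemma 4.1.1/4.1.4 (held: `doi:10.1007/s10240-008-0016-1` pp. 116–119; 4.1.4 is the
    algebraic version `ψ∘N = χ∘N` WITH the parity hypothesis "`χ_v(-1)` independent of `v`").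
    Restriction `HeckeCharacter K → HeckeCharacter F₀` along `ideleBaseChange` and its values at
    uniformizers: PROVED (PackageHecke.lean).
(e) `τ' := Π_K ⊗ ψ₀`, `ψ₁ := ψ₀‖·‖^{-n/2}`, infinity type: twist by ANY Hecke character P
    (`AutomorphicTwistHecke.lean:451 exists_cuspidalAutomorphicRepData_twist_hecke`, Satake a.e.
    `eventually_hasSatakeParamAt_of_map_mulChar_detTwist`); PLACEWISE twist at an unramified place
    needs a level prime to `u` for a general `χ`: PROVED (PackageDict.lean §3
    `heckeCharacter_exists_level_not_dvd`, `hasSatakeParamAt_twist_hecke_placewise`).  Archimedean: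
    F `ArthurClozel1989_strongLifting_archimedean` (`BaseChangeArchimedean.lean:152`, ⇒
    `hasInfinityType_baseChange :173`), F `Henniart2012_infinityType_of_automorphicInduction`
    (`HenniartAutomorphicInduction.lean:137`, `.quadratic :186`), F `AutomorphicRepData.exists_hasInfinityType`
    (`AutomorphicRepsGL.lean:409`), norm twist P (`ArchParameterTwistNorm.lean:450
    HasInfinityType.of_map_mulChar_detTwist`, `s` real), general `GL₁` twist P
    (`Theorems/IrreducibilityBySelfDualityRegularTwistCMTwistRealisation.lean:140
    hasArchParameter_twist_glOne` + `Theorems/HalfIntegralTwistCM/Negative/ArchParameterGLOne.lean: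
    archParam_complexPlace_glOne, archParam_sub_conj_eq_of_hasUnitaryArchType, detTwist_datum_heckeCharacter`);
    `IsWeaklyRegular` (`WeaklyRegularGaloisRep.lean:138`; `IsRegular.isWeaklyRegular :152`),
    `IsCAlgebraic` (`InfinityType.lean:133`).  Clozel purity `p_i + q_i = -k`: not needed (weak
    regularity reads the `a`-exponents only).
(f) conj. self-duality a.e. of `τ'` from `hpol`: `Π`-level PROVED (`PackagePolar.lean:
    inducedParam_map_inv`), `K`-level algebra PROVED (ibid. §4: `map_pow_map_inv`,
    `map_mul_eq_map_inv_of_mul_eq`, `map_mul_eq_map_inv_self`), values of `ψ₀` at conjugate places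
    from `valueAtUniformizer_restrict` (PackageHecke.lean); remaining: the a.e. threading (S–M) +
    `IsWeakBaseChangeLiftAE.isGaloisStableSatakeAE` (`BaseChangeGLnProofs.lean:138`); no SMO needed
    (consumer takes `IsConjSelfDualAE`; the pairing bridge is the galoisOverK worker's fact).
(g) pane: `hpin` (existence of `κ_P`: F `Mok2014_partialAsaiL_pole_dichotomy`, DEPRECATED def
    `AsaiSign.lean:810` — `pkg_member` takes its body as the hypothesis `hMok`; consequences
    `exists_hasAsaiSign :906`, `existsUnique_hasAsaiSign :915`; Asai data exist
    `Theorems/HostInducedRep/Negative/AsaiSignHazard.lean:95 exists_isAsaiDatum`); tower places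
    (asaiPoleInduced worker, `work/stubs/AsaiTowerPlaces.lean`); `AI ∘ BC = BC ∘ AI` a.e. P
    (`BaseChangeOfAutomorphicInduction.lean:229 eventually_hasSatakeParamAt_sum_smul`); the TYPE
    `L = F·K` with its four algebra structures: M (M-size; `IsEmpty (F →ₐ[F₀] K)` is the hypothesis
    of `pkg_member` guaranteeing `F ⊗ K` is a field).
(h) sign logic: §1 below (P).  (i) dictionary: PackageDict.lean §2 (P) + landed `…SignedTwistAux.lean:281
    hostPoly_eq_arithFrobPolyOfSatake`, `scaleRoots_arithFrobPolyOfSatake_twist(_sq)`.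
SIZES of what is left inside `pkg_member` (S ≤ 100 lines, M ≤ 400, L ≤ 1000, XL > 1000):
  Satake side (AI/BC/twist placewise, DICT-AE, COV, `IsConjSelfDualAE`): M left after this wave's
  `member_dictionary`, `inducedParam_map_inv`, restriction lemmas (the objects `θ`, `U`, `ψ₀` and the
  a.e. threading remain), facts hAI hBC hext;
  `hext` from Hewitt–Ross: M–L; archimedean side (`HasInfinityType`, weak regularity, C-algebraicity
  ⟺ type I, `ψ₁` algebraic, pane `HasArchParameter` with Nodup/card/coset): L–XL, facts harch hHen
  hinf; pane object `P` over `L = F·K` (type + cuspidal BC to `L` via hBC + twist by `ψ₀∘N` +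
  `IsAutomorphicInductionAlong P τ'` + `IsConjSelfDualAE s`): XL; sign step (hpin + hMok ⇒ parity
  constancy, `exists_switch_const`/`exists_xi`/`negOnePow_typeI`, hpane ⇒ `HasAsaiSign 1`): M.
GATE (2026-08-16, `ledger propose --kind proof --supports stmt-Langlands-10902 --dry-run`): every
landable file → "would-be verdict: ACCEPT [stage route]" (the only note: "disables a linter" =
`dupNamespace`, as the landed siblings); two earlier near-duplicates (`GLn.ofFinite_sndHom_of_mem`,
`satakePolynomial_add`) were replaced by the tree's lemmas.  Axioms of `stub_package_of_member`,
`dictionary_powers`, `heckeCharacter_exists_level_not_dvd`: {propext, Classical.choice, Quot.sound}.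
WAVE 2 (2026-08-16): the helper files land `--supports` through registered ANCHOR theorems
(`packageSign_anchor`, `packageDict_anchor`, `packageHecke_anchor`, `packagePolar_anchor`; the family
file through `stub_package_of_member`); the sub-stub `pkg_member` is split into registered sub-stubs
(Satake side / archimedean side / pane object / sign step), see `…PackageSplit.lean`.
-/

open scoped BigOperators Polynomial
open Polynomial IsDedekindDomain NumberField
open Literature.NumberTheory.Automorphic Literature.NumberTheory.GaloisRepresentations
open Summit.Langlands.Langlands.Theorems.HostInducedRep.GrsExplicitDescent

-- `Summit.Langlands.Langlands.…` (summit = sub-problem name, D-0017 layout) trips `dupNamespace`.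
set_option linter.dupNamespace false

noncomputable section

namespace Summit.Langlands.Langlands.Theorems.HostInducedRep.OneTransparentPane

/-! ## §1 Sign bookkeeping: the `e ↔ e·ω_{F/F₀}` switch and the choice of `ξ ∈ {1, ω_K}` -/

section Sign

/-- **The switch-and-`ξ` lemma.**  Let `V` be the real places of `F₀`, `cx v` mean "`v` is of
complex type in `F`" and `d v = det e(c_v) ∈ {±1}` the parity of the polarization character at `v`.
If `d` is constant on the split-type places (`hpar`) and constant on the complex-type places (the
sign pin at the panes), then for a suitable switch `ε ∈ {±1}` applied on the complex-type places
only (the effect of `e ↦ e · ω_{F/F₀}`, which flips `d` exactly at the complex-type places) the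
switched parity is constant on all of `V`. [folklore] -/
theorem exists_switch_const {V : Type*} (cx : V → Prop) [DecidablePred cx] (d : V → ℤˣ)
    (hsplit : ∀ v w, ¬ cx v → ¬ cx w → d v = d w) (hcx : ∀ v w, cx v → cx w → d v = d w) :
    ∃ ε c : ℤˣ, ∀ v, (if cx v then ε * d v else d v) = c := by
  by_cases hs : ∃ v₀, ¬ cx v₀
  · obtain ⟨v₀, hv₀⟩ := hs
    by_cases hc : ∃ v₁, cx v₁
    · obtain ⟨v₁, hv₁⟩ := hc
      refine ⟨d v₀ * (d v₁)⁻¹, d v₀, fun v ↦ ?_⟩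
      split_ifs with h
      · rw [hcx v v₁ h hv₁, inv_mul_cancel_right]
      · exact hsplit v v₀ h hv₀
    · push Not at hc
      exact ⟨1, d v₀, fun v ↦ by rw [if_neg (hc v)]; exact hsplit v v₀ (hc v) hv₀⟩
  · push Not at hs
    by_cases hc : ∃ v₁, cx v₁
    · obtain ⟨v₁, hv₁⟩ := hc
      exact ⟨1, d v₁, fun v ↦ by rw [if_pos (hs v), one_mul]; exact hcx v v₁ (hs v) hv₁⟩
    · push Not at hc
      exact ⟨1, 1, fun v ↦ absurd (hs v) (hc v)⟩

/-- **Choice of `ξ`.**  Once the (switched) parity `c` is constant, `ξ := c · (-1)^{n+k}` is the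
sign with `c = ξ · (-1)^{n+k}` — the normalisation making every infinite place of type I
(`negOnePow_typeI`). [folklore] -/
theorem exists_xi (c : ℤˣ) (n k : ℤ) : ∃ ξ : ℤˣ, c = ξ * (n + k).negOnePow :=
  ⟨c * (n + k).negOnePow, by rw [mul_assoc, Int.units_mul_self, mul_one]⟩

/-- **Type I from the parity identity.**  At a complex place `u` of `K` over the real place `v` of
`F₀` the unitary part of `ψ₀` is `(z/|z|)^{m}` with `(-1)^m = c · ξ` (`c` the parity of the finite
part of the restricted character at `v`, `ξ = ξ_v(-1)`); if `c = ξ · (-1)^{n+k}` then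
`m + k ≡ n (mod 2)`, i.e. the exponents `p_i + (m + k)/2` (`p_i ∈ (n-1)/2 + ℤ`) lie in `½ + ℤ`:
the place is of type I for `GL_{2n}`. [folklore] -/
theorem negOnePow_typeI {m n k : ℤ} {c ξ : ℤˣ} (hc : c = ξ * (n + k).negOnePow)
    (hm : m.negOnePow = c * ξ) : (m + k).negOnePow = n.negOnePow := by
  rw [hc, mul_right_comm, Int.units_mul_self, one_mul] at hm
  rw [Int.negOnePow_add, hm, Int.negOnePow_add, mul_right_comm, mul_assoc, Int.units_mul_self, mul_one]

/-- The same in the currency of half-integral exponents: if `(m + k)` and `n` have the same parity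
and `p ∈ (n-1)/2 + ℤ`, then `p + (m + k)/2 ∈ ½ + ℤ` (in `ℂ`). [folklore] -/
theorem exists_int_add_half_of_parity {m n k : ℤ} (h : (m + k).negOnePow = n.negOnePow)
    {p : ℂ} (hp : ∃ j : ℤ, p = j + ((n : ℂ) - 1) / 2) :
    ∃ j : ℤ, p + ((m : ℂ) + k) / 2 = (j : ℂ) + 1 / 2 := by
  obtain ⟨j, rfl⟩ := hp
  obtain ⟨r, hr⟩ := (Int.negOnePow_eq_iff _ _).mp h
  refine ⟨j + r + n - 1, ?_⟩
  have hr' : ((m : ℂ) + k) = 2 * r + n := by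
    have := congrArg (fun x : ℤ ↦ (x : ℂ)) hr
    push_cast at this ⊢
    linear_combination this
  rw [hr']
  push_cast
  ring

end Sign

/-- **Registered anchor** of this helper file (stub registry of stmt-Langlands-10902, line
`one-transparent-pane`, package helper "Sign"): the choice of `ξ` (`exists_xi`). [folklore] -/
theorem packageSign_anchor : ∀ (c : ℤˣ) (n k : ℤ), ∃ ξ : ℤˣ, c = ξ * (n + k).negOnePow :=
  exists_xi

end Summit.Langlands.Langlands.Theorems.HostInducedRep.OneTransparentPane

end
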